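/-
Free seat `ym-line-cbag-p1` LEAD (prover-ym-line-cbag-p1-g5-0; own items 22254 `BoxFloorAllGroups` / 22893 `ExpChartPackage2` closed), route
`ColdBoxAllGroups`, helping crux `BulkAllGroups` (stmt-QuantumFields-22255), line `dlr-chessboard-G` (lead `ym-line-cbag-p2`): the scaled
background circulation of the datum is eventually a small fraction of the small-field threshold — G-port of
`…BulkDominatesColdBoxWShiftSmall.dirBackground_shift_small_eventually` (`√(2β) ↦ √β`, `16 ↦ CE`, `Fin 3 ↦ Fin D`, `¼ ↦ κ`).
-/
import Summits.QuantumFields.YangMills.Theorems.WeakCouplingRatesBulkDominatesColdBoxWShiftSmall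
import Summits.QuantumFields.YangMills.Theorems.WeakCouplingRatesEventuallyPow

/-!
# Crux `BulkAllGroups` (stmt-QuantumFields-22255), stubs N2-mean-G / N2-cov-G: the mean shift is eventually below any fixed fraction of the
# small-field threshold (any number of colours, any energy constant, `√β`-scaling)

In the exponential chart of a compact group the Gaussian variables are `t = √β·a`, so the background circulation of colour `c` entering the cores is
`√β·F̄_c(p)`, `F̄_c = sCirc (glue ϑ_c (mean ϑ_c))`.  From the energy clause of the datum package (`exists_datum_packageG`:
`Σ_c M_{ϑ_c}(s_c) ≤ CE·(2H+3)⁴·β^{2δ−1}`, `H = ⌈β^θ⌉`) and `F̄_c(p)² ≤ M_{ϑ_c}(s_c)` on the plaquettes touching the cold box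
(`dirBackground_touching_sq_le_formM`, G-free):

* `sqrt_beta_mul_abs_dirBackground_le_of_sum` — `√β·|F̄_c(p)| ≤ √(β·B)` for touching `p` whenever `Σ_c M_{ϑ_c}(s_c) ≤ B` (`D` colours);
* `sqrt_beta_energy_eq` — `√(β·CE·X⁴·β^{2δ−1}) = √CE·X²·β^δ` (`X = 2H+3`);
* **`dirBackground_shift_small_eventuallyG`** — for `0 < θ`, `2θ + δ < ε`, any `CE` and any `κ > 0` there is `β₀ ≥ 1` such that for `β ≥ β₀`,
  every `D`, every datum `ϑ : Fin D → edges → ℝ` and competitors `s` with the energy clause, every touching plaquette and every colour: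
  `√β·|F̄_c(p)| ≤ κ·β^ε` (`…EventuallyPow.exists_const_mul_boxSide_pow_mul_rpow_le` with `2θ + δ < ε`).
No new definition; no sorry; standard axioms.  NOT a claim about the mass gap: rung-level support (R2xi-G `XiPow`, RECORD label); the Yang–Mills
mass gap is NOT proved by any of this.
-/

set_option autoImplicit false

noncomputable section

open Finset
open Literature.Probability.LatticeModels Literature.MathematicalPhysics.QuantumLattice
open Literature.MathematicalPhysics.QuantumFieldTheory Literature.MathematicalPhysics.QuantumFieldTheory.AxialGauge
open Literature.MathematicalPhysics.QuantumFieldTheory.LatticeMaxwell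
open Summit.QuantumFields.YangMills.Theorems.WeakCouplingRates

namespace Summit.QuantumFields.YangMills.Theorems.ColdBoxAllGroups

/-- **`√β·|F̄_c(p)| ≤ √(β·B)`** on a plaquette touching the cold box, from the `D`-colour energy bound `Σ_c M_{ϑ_c}(s_c) ≤ B`. [folklore] -/
theorem sqrt_beta_mul_abs_dirBackground_le_of_sum {D : ℕ} (H : ℕ) {β B : ℝ} (hβ : 0 ≤ β)
    (ϑ : Fin D → Literature.MathematicalPhysics.QuantumLattice.ZdEdge 4 → ℝ) (s : Fin D → DirFree H → ℝ)
    (hE : ∑ c, formM (fun e => e ∉ dirFreeEdges H) dirCorner (2 * H + 3) (ϑ c) (s c) ≤ B)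
    {p : ZdPlaquette 4} (hp : p ∈ plaquettesTouching (boxEdges 4 (2 * H + 1))) (c : Fin D) :
    Real.sqrt β * |sCirc (LatticeMaxwell.glue (pin := fun e => e ∉ dirFreeEdges H) dirCorner (2 * H + 3) (ϑ c)
        (mean (fun e => e ∉ dirFreeEdges H) dirCorner (2 * H + 3) (ϑ c))) (p.1, p.2.1.1, p.2.1.2)| ≤ Real.sqrt (β * B) := by
  set F : ℝ := sCirc (LatticeMaxwell.glue (pin := fun e => e ∉ dirFreeEdges H) dirCorner (2 * H + 3) (ϑ c)
        (mean (fun e => e ∉ dirFreeEdges H) dirCorner (2 * H + 3) (ϑ c))) (p.1, p.2.1.1, p.2.1.2) with hF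
  have h1 : F ^ 2 ≤ formM (fun e => e ∉ dirFreeEdges H) dirCorner (2 * H + 3) (ϑ c) (s c) :=
    dirBackground_touching_sq_le_formM H (ϑ c) (s c) hp
  have h2 : formM (fun e => e ∉ dirFreeEdges H) dirCorner (2 * H + 3) (ϑ c) (s c) ≤
      ∑ c', formM (fun e => e ∉ dirFreeEdges H) dirCorner (2 * H + 3) (ϑ c') (s c') :=
    Finset.single_le_sum (f := fun c' => formM (fun e => e ∉ dirFreeEdges H) dirCorner (2 * H + 3) (ϑ c') (s c'))
      (fun c' _ => formM_nonneg _ _) (Finset.mem_univ c)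
  have habs : |F| ≤ Real.sqrt B := by
    rw [← Real.sqrt_sq_eq_abs]; exact Real.sqrt_le_sqrt (h1.trans (h2.trans hE))
  calc Real.sqrt β * |F| ≤ Real.sqrt β * Real.sqrt B := by gcongr
    _ = Real.sqrt (β * B) := by rw [← Real.sqrt_mul hβ]

/-- `√(β·(CE·X⁴·β^{2δ−1})) = √CE·(X²·β^δ)` for `β > 0`. [folklore] -/
theorem sqrt_beta_energy_eq {β CE δ : ℝ} (hβ : 0 < β) (X : ℝ) :
    Real.sqrt (β * (CE * X ^ 4 * β ^ (2 * δ - 1))) = Real.sqrt CE * (X ^ 2 * β ^ δ) := by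
  have e1 : β * β ^ (2 * δ - 1) = (β ^ δ) ^ 2 := by
    rw [show (β ^ δ) ^ 2 = β ^ (2 * δ) by
      rw [show (2 : ℝ) * δ = δ * ((2 : ℕ) : ℝ) by push_cast; ring, Real.rpow_mul_natCast hβ.le]]
    rw [show β * β ^ (2 * δ - 1) = β ^ (1 : ℝ) * β ^ (2 * δ - 1) by rw [Real.rpow_one], ← Real.rpow_add hβ]
    ring_nf
  have hY : 0 ≤ X ^ 2 * β ^ δ := by positivity
  have hin : β * (CE * X ^ 4 * β ^ (2 * δ - 1)) = CE * (X ^ 2 * β ^ δ) ^ 2 := by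
    linear_combination (CE * X ^ 4) * e1
  rw [hin, Real.sqrt_mul' _ (by positivity), Real.sqrt_sq hY]

/-- **The mean shift is eventually below any fixed fraction of the small-field threshold (G-port).**  For `0 < θ`, `2θ + δ < ε`, an energy
constant `CE` and a fraction `κ > 0` there is `β₀ ≥ 1` such that for `β ≥ β₀`, `H = ⌈β^θ⌉`, every number of colours `D`, every datum `ϑ` and
competitors `s` with `Σ_c M_{ϑ_c}(s_c) ≤ CE(2H+3)⁴β^{2δ−1}`, every plaquette `p` touching the cold box and every colour:
`√β·|F̄_c(p)| ≤ κ·β^ε`. [folklore] -/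
theorem dirBackground_shift_small_eventuallyG {θ δ ε : ℝ} (CE : ℝ) {κ : ℝ} (hθ : 0 < θ) (hε : 2 * θ + δ < ε) (hκ : 0 < κ) :
    ∃ β₀ : ℝ, 1 ≤ β₀ ∧ ∀ β : ℝ, β₀ ≤ β → ∀ {D : ℕ} (ϑ : Fin D → Literature.MathematicalPhysics.QuantumLattice.ZdEdge 4 → ℝ)
      (s : Fin D → DirFree ⌈β ^ θ⌉₊ → ℝ),
      ∑ c, formM (fun e => e ∉ dirFreeEdges ⌈β ^ θ⌉₊) dirCorner (2 * ⌈β ^ θ⌉₊ + 3) (ϑ c) (s c) ≤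
          CE * (2 * (⌈β ^ θ⌉₊ : ℝ) + 3) ^ 4 * β ^ (2 * δ - 1) →
        ∀ p ∈ plaquettesTouching (boxEdges 4 (2 * ⌈β ^ θ⌉₊ + 1)), ∀ c : Fin D,
          Real.sqrt β * |sCirc (LatticeMaxwell.glue (pin := fun e => e ∉ dirFreeEdges ⌈β ^ θ⌉₊) dirCorner (2 * ⌈β ^ θ⌉₊ + 3) (ϑ c)
              (mean (fun e => e ∉ dirFreeEdges ⌈β ^ θ⌉₊) dirCorner (2 * ⌈β ^ θ⌉₊ + 3) (ϑ c))) (p.1, p.2.1.1, p.2.1.2)| ≤ κ * β ^ ε := by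
  have hk : ((2 : ℕ) : ℝ) * θ + δ < ε := by push_cast; linarith
  obtain ⟨β₀, hβ₀1, hev⟩ := exists_const_mul_boxSide_pow_mul_rpow_le (Real.sqrt CE / κ) 2 hθ hk
  refine ⟨β₀, hβ₀1, fun β hβ D ϑ s hE p hp c => ?_⟩
  have hβ1 : (1 : ℝ) ≤ β := hβ₀1.trans hβ
  have hβ0 : 0 < β := by linarith only [hβ1]
  have h0 := sqrt_beta_mul_abs_dirBackground_le_of_sum ⌈β ^ θ⌉₊ hβ0.le ϑ s hE hp c
  refine h0.trans ?_
  rw [sqrt_beta_energy_eq hβ0 (2 * (⌈β ^ θ⌉₊ : ℝ) + 3)]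
  -- `√CE·X²β^δ ≤ κβ^ε` from `(√CE/κ)·X²·β^δ ≤ β^ε`
  have h := hev β hβ
  have h' : Real.sqrt CE * ((2 * (⌈β ^ θ⌉₊ : ℝ) + 3) ^ 2 * β ^ δ) = κ * (Real.sqrt CE / κ * (2 * (⌈β ^ θ⌉₊ : ℝ) + 3) ^ 2 * β ^ δ) := by
    field_simp
  rw [h']
  exact mul_le_mul_of_nonneg_left h hκ.le

end Summit.QuantumFields.YangMills.Theorems.ColdBoxAllGroups

end
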